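/-
Copyright (c) 2026 The HCML crux team. All rights reserved.
Released under Apache 2.0 license as described in the file LICENSE.
Authors: K2E3-p14 (g5) (explicit-unit `hodgecm-mathlib-K2E3-p14-g5`)
-/
import Summits.HodgeConjecture.HodgeConjecture.Theorems.K2E3GLnAdHeightBalls     -- ★ (B4-0 file 1) p857992 (this seat): the balls `𝔅_m`, `exists_zpow_scalar_mul_integral_of_adBall`
import Literature.NumberTheory.Automorphic.IwasawaDecompositionGL               -- ★ `zpowDiagGL`, `coe_zpowDiagGL`, `zpowDiagGL_neg`
import HarnessLib

/-!
# (GL-[M6]-sc, T18-split ∕ «RADIUS») Harish-Chandra's Theorem 18 at the split Cartan of `GL₃`, with explicit exponent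

Cell `hodgecm-mathlib`, Track B, line `K2_E3_EllipticInputs`; payer «GL-[M6]-sc» of leaf (11-3-split-sc) ∕ (11-3-split-sc-NE) (dealer K2E3-plan (g3) D63, line
lead K2E3-p23 (g5), RULINGS #10 (M10-2) «RADIUS», BLUEPRINT v3 §1).  Harish-Chandra's Theorem 18 [HarishChandra1970, Part VII §2 p. 69; Cor. p. 69; §3 p. 71
(ii)]: conjugation `G∕A → G`, `x̄ ↦ x t x⁻¹`, by a REGULAR `t` of the split Cartan `A` is proper, the height of `x̄` being controlled LINEARLY by the height of
`x t x⁻¹` and the logarithmic discriminant of `t`.  At `GL₃` the line lead's Lagrange short-cut gives an EXPLICIT exponent with no induction: for `t = diag(d)`,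
conjugating the Lagrange idempotent `(t − d_{k'})(t − d_{k''}) = Δ_k E_{kk}` by `x` yields `x_{ik} · Δ_k · (x⁻¹)_{kl} = ((y − d_{k'}·1)(y − d_{k''}·1))_{il}`
(`y = x t x⁻¹`, §1); so for `y` integral with `ϖ^s y⁻¹` integral: `|d_j| ≤ 1`, `|ϖ^s d_j⁻¹| ≤ 1` (top entry of a column of `x` in `x t = y x`), `|δ · x_{ik}(x⁻¹)_{kl}| ≤ 1`
with `δ = ((d₀−d₁)(d₀−d₂)(d₁−d₂))² = −Δ₀Δ₁Δ₂`, and normalising the COLUMNS of `x` by `a = diag(ϖ^{e}) ∈ A` gives `x·a ∈ 𝔅_{6s+L}` whenever `|D♮(t)| ≥ q^{−L}`,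
`D♮ = δ∕(d₀d₁d₂)²` the scale-invariant discriminant (§2).  In the currency of ★ B4-0 (`𝔅_m(g) :≡ ∀ i j k l, |ϖ^m g_{ij} (g⁻¹)_{kl}| ≤ 1`, scale-invariant):
* §1 (any field, any finite index type) `conj_diagonal_sub`, **`apply_mul_mul_inv_apply_eq_of_forall_ne`** (the Lagrange identity), the eigenvalue bounds
  `v_mul_le_one_of_mul_diagonal_eq` (column) ∕ `v_mul_le_one_of_diagonal_mul_eq` (row), `v_mul_apply_le_one`, `v_sub_smul_one_apply_le_one`.
* §2 (`Fin 3`, `[Valued F ℤᵐ⁰]` only — no local-field structure; regularity is encoded in `hD`) `v_eigenvalue_le_one_of_conj`, `v_pow_mul_eigenvalue_inv_le_one_of_conj`,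
  `v_disc_mul_apply_mul_inv_apply_le_one`, `exists_adBall_mul_zpowDiagGL_of_conj_integral`, and the payload
  **`exists_adBall_mul_zpowDiagGL_of_adBall_conj (hϖ) (hϖ0) (ht : ↑t = diagonal d) (hy : 𝔅_s(x t x⁻¹)) (hD : |ϖ^L (d₀d₁d₂)²| ≤ |δ|) : ∃ e, 𝔅_{6s+L}(x · zpowDiagGL e)`**
  — Theorem 18 AND its Corollary: with `s := R₀` (`tsupport θ ⊆ Ω R₀`) it is the `hsupp`∕`m_C = 6R₀ + L` input of Theorem 20 at `GL₃`, with `s := σ(γ)` it is the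
  `y₀`-normalisation `σ(ȳ₀) ≤ 6σ(γ) + L` of p. 71 (ii); plus `exists_depth_of_injective`.
* The `G_Λ = GL₃(F) ⧸ Λ₀·1` reading (conjugating set `⊆ Ω(6R₀+L) · mk(ϖ^{ℤ³})`) is the companion file `K2E3GL3ModCocompactSplitTorusRadius` (400-line law).

HONEST LABEL: HC_CM is proved only modulo the 7 printed citations (2 remaining named inputs: hLiu418 = stmt-HodgeConjecture-24832, h413 =
stmt-HodgeConjecture-24833) until rung 0 closes; count-neutral (kernel lane `--supports stmt-HodgeConjecture-24833 --as helper`), THEOREMS ONLY — no `def`, no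
instance, no notation, no `sorry`.  Theorem 18 for the SPLIT Cartan only; the mixed tori `E^× × F^×` (T18-mixed) and Theorems 14∕15∕19∕20 are other bricks.
References: Harish-Chandra (van Dijk), *Harmonic Analysis on Reductive p-adic Groups*, LNM 162 (1970), Part VII §2 Thm 18 + Cor. p. 69, §3 p. 71 (ii), p. 72
[cite: HarishChandra1970, Part VII §2 Theorem 18 p. 69]; P. Cartier, PSPM 33.1 (1979) §IV.1 [cite: Cartier1979, §IV.1].
-/

open Set Function
open scoped MatrixGroups Pointwise WithZero Topology
open Matrix
open Literature.NumberTheory.Automorphic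
open Summit.HodgeConjecture.HodgeConjecture.Cruxes.H413.K2E3GLnAdHeightBalls

set_option linter.dupNamespace false

noncomputable section

namespace Summit.HodgeConjecture.HodgeConjecture.Cruxes.H413.K2E3GL3TruncatedCharSplitTorusRadius

/-! ## §1 The Lagrange identity and the eigenvalue bounds (any field, any finite index type) -/

section Lagrange

variable {F : Type*} [Field F] {n : Type*} [Fintype n] [DecidableEq n]

/-- `x · diag(d − c) · x⁻¹ = x·diag(d)·x⁻¹ − c·1`. [folklore] -/
theorem conj_diagonal_sub (x : GL n F) (d : n → F) (c : F) :
    (x : Matrix n n F) * Matrix.diagonal (fun m => d m - c) * ((x⁻¹ : GL n F) : Matrix n n F) =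
      (x : Matrix n n F) * Matrix.diagonal d * ((x⁻¹ : GL n F) : Matrix n n F) - c • (1 : Matrix n n F) := by
  have hxx : (x : Matrix n n F) * ((x⁻¹ : GL n F) : Matrix n n F) = 1 := by rw [← Units.val_mul, mul_inv_cancel, Units.val_one]
  have hD : Matrix.diagonal (fun m => d m - c) = Matrix.diagonal d - c • (1 : Matrix n n F) := by
    ext i j
    by_cases hij : i = j
    · subst hij
      rw [Matrix.sub_apply, Matrix.diagonal_apply_eq, Matrix.diagonal_apply_eq, Matrix.smul_apply, Matrix.one_apply_eq, smul_eq_mul, mul_one]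
    · rw [Matrix.sub_apply, Matrix.diagonal_apply_ne _ hij, Matrix.diagonal_apply_ne _ hij, Matrix.smul_apply, Matrix.one_apply_ne hij, smul_zero, sub_zero]
  rw [hD, Matrix.mul_sub, Matrix.sub_mul, Matrix.mul_smul, Matrix.mul_one, Matrix.smul_mul, hxx]

/-- **THE LAGRANGE IDENTITY** (line lead K2E3-p23 (g5), RULINGS #10 (M10-2)).  For `t = diag(d)`, an index `k` and scalars `c₁, c₂` killing the other diagonal
entries (`(d_m − c₁)(d_m − c₂) = 0` for `m ≠ k`; at `GL₃` take `{c₁, c₂} = {d_{k'}, d_{k''}}`):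
`x_{ik} · (d_k − c₁)(d_k − c₂) · (x⁻¹)_{kl} = ((y − c₁·1)(y − c₂·1))_{il}` with `y = x t x⁻¹` — conjugation of the Lagrange idempotent `(t − c₁)(t − c₂) = Δ_k E_{kk}`.
[cite: HarishChandra1970, Part VII §2 Theorem 18 p. 69] -/
theorem apply_mul_mul_inv_apply_eq_of_forall_ne {t : GL n F} {d : n → F} (ht : (t : Matrix n n F) = Matrix.diagonal d) (k : n) {c₁ c₂ : F}
    (hk : ∀ m, m ≠ k → (d m - c₁) * (d m - c₂) = 0) (x : GL n F) (i l : n) :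
    (x : Matrix n n F) i k * ((d k - c₁) * (d k - c₂)) * ((x⁻¹ : GL n F) : Matrix n n F) k l =
      ((((x * t * x⁻¹ : GL n F) : Matrix n n F) - c₁ • (1 : Matrix n n F)) * (((x * t * x⁻¹ : GL n F) : Matrix n n F) - c₂ • (1 : Matrix n n F))) i l := by
  have hx'x : ((x⁻¹ : GL n F) : Matrix n n F) * (x : Matrix n n F) = 1 := by rw [← Units.val_mul, inv_mul_cancel, Units.val_one]
  have hy : ((x * t * x⁻¹ : GL n F) : Matrix n n F) = (x : Matrix n n F) * Matrix.diagonal d * ((x⁻¹ : GL n F) : Matrix n n F) := by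
    rw [Units.val_mul, Units.val_mul, ht]
  -- `(y − c₁)(y − c₂) = x · diag((d − c₁)(d − c₂)) · x⁻¹`
  have hprod : (((x * t * x⁻¹ : GL n F) : Matrix n n F) - c₁ • (1 : Matrix n n F)) * (((x * t * x⁻¹ : GL n F) : Matrix n n F) - c₂ • (1 : Matrix n n F)) =
      (x : Matrix n n F) * Matrix.diagonal (fun m => (d m - c₁) * (d m - c₂)) * ((x⁻¹ : GL n F) : Matrix n n F) := by
    rw [hy, ← conj_diagonal_sub, ← conj_diagonal_sub,
      show Matrix.diagonal (fun m => (d m - c₁) * (d m - c₂)) = Matrix.diagonal (fun m => d m - c₁) * Matrix.diagonal (fun m => d m - c₂) from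
        (Matrix.diagonal_mul_diagonal _ _).symm]
    simp only [Matrix.mul_assoc]
    rw [← Matrix.mul_assoc ((x⁻¹ : GL n F) : Matrix n n F) (x : Matrix n n F), hx'x, Matrix.one_mul]
  rw [hprod, Matrix.mul_apply, Finset.sum_eq_single k]
  · simp only [Matrix.mul_diagonal]
  · intro m _ hm
    simp only [Matrix.mul_diagonal]
    rw [hk m hm, mul_zero, zero_mul]
  · intro h; exact absurd (Finset.mem_univ k) h

/-- Every COLUMN of an invertible matrix has a non-zero entry. [folklore] -/
theorem exists_apply_ne_zero_of_col (x : GL n F) (j : n) : ∃ i, (x : Matrix n n F) i j ≠ 0 := by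
  by_contra h
  rw [not_exists] at h
  have h1 : (((x⁻¹ * x : GL n F)) : Matrix n n F) j j = 1 := by rw [inv_mul_cancel, Units.val_one, Matrix.one_apply_eq]
  rw [Units.val_mul, Matrix.mul_apply, Finset.sum_eq_zero fun i _ => by rw [not_not.1 (h i), mul_zero]] at h1
  exact zero_ne_one h1

/-- Every ROW of an invertible matrix has a non-zero entry. [folklore] -/
theorem exists_apply_ne_zero_of_row (x : GL n F) (i : n) : ∃ j, (x : Matrix n n F) i j ≠ 0 := by
  by_contra h
  rw [not_exists] at h
  have h1 : (((x * x⁻¹ : GL n F)) : Matrix n n F) i i = 1 := by rw [mul_inv_cancel, Units.val_one, Matrix.one_apply_eq]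
  rw [Units.val_mul, Matrix.mul_apply, Finset.sum_eq_zero fun j _ => by rw [not_not.1 (h j), zero_mul]] at h1
  exact zero_ne_one h1

variable [Valued F ℤᵐ⁰]

/-- **EIGENVALUE BOUND, COLUMN FORM**: if `X · diag(d) = Y · X`, column `j` of `X` is non-zero and `|c Y_{im}| ≤ 1` for all entries, then `|c d_j| ≤ 1` — read
`x_{i₀ j} d_j = Σ_m y_{i₀ m} x_{mj}` at the TOP entry `i₀` of column `j`. [cite: HarishChandra1970, Part VII §2 Theorem 18 p. 69] -/
theorem v_mul_le_one_of_mul_diagonal_eq {X Y : Matrix n n F} {d : n → F} (h : X * Matrix.diagonal d = Y * X) {c : F}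
    (hY : ∀ i m, Valued.v (c * Y i m) ≤ 1) (j : n) (hj : ∃ i, X i j ≠ 0) : Valued.v (c * d j) ≤ 1 := by
  obtain ⟨i₁, hi₁⟩ := hj
  obtain ⟨i₀, -, hi₀⟩ := Finset.exists_max_image (Finset.univ : Finset n) (fun i => Valued.v (X i j)) ⟨i₁, Finset.mem_univ _⟩
  have hγ0 : Valued.v (X i₀ j) ≠ 0 := by
    intro h0
    have h1 := hi₀ i₁ (Finset.mem_univ _)
    rw [h0, le_zero_iff] at h1
    exact hi₁ ((Valuation.zero_iff _).1 h1)
  have hentry := congrFun (congrFun h i₀) j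
  rw [Matrix.mul_diagonal, Matrix.mul_apply] at hentry
  -- `|X_{i₀ j}| · |c d_j| = |Σ_m (c Y_{i₀ m}) X_{mj}| ≤ |X_{i₀ j}|`
  have hle : Valued.v (X i₀ j) * Valued.v (c * d j) ≤ Valued.v (X i₀ j) * 1 := by
    rw [mul_one, ← map_mul, mul_left_comm, hentry, Finset.mul_sum]
    refine Valuation.map_sum_le _ fun m _ => ?_
    rw [← mul_assoc, map_mul]
    calc Valued.v (c * Y i₀ m) * Valued.v (X m j) ≤ 1 * Valued.v (X i₀ j) := mul_le_mul' (hY i₀ m) (hi₀ m (Finset.mem_univ _))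
      _ = Valued.v (X i₀ j) := one_mul _
  calc Valued.v (c * d j) = (Valued.v (X i₀ j))⁻¹ * (Valued.v (X i₀ j) * Valued.v (c * d j)) := by rw [inv_mul_cancel_left₀ hγ0]
    _ ≤ (Valued.v (X i₀ j))⁻¹ * (Valued.v (X i₀ j) * 1) := mul_le_mul_right hle _
    _ = 1 := by rw [mul_one, inv_mul_cancel₀ hγ0]

/-- **EIGENVALUE BOUND, ROW FORM**: if `diag(d) · X = X · Y`, row `j` of `X` is non-zero and `|c Y_{ml}| ≤ 1` for all entries, then `|c d_j| ≤ 1` (transpose of the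
column form). [cite: HarishChandra1970, Part VII §2 Theorem 18 p. 69] -/
theorem v_mul_le_one_of_diagonal_mul_eq {X Y : Matrix n n F} {d : n → F} (h : Matrix.diagonal d * X = X * Y) {c : F}
    (hY : ∀ m l, Valued.v (c * Y m l) ≤ 1) (j : n) (hj : ∃ l, X j l ≠ 0) : Valued.v (c * d j) ≤ 1 := by
  have hT : X.transpose * Matrix.diagonal d = Y.transpose * X.transpose := by
    rw [← Matrix.diagonal_transpose, ← Matrix.transpose_mul, ← Matrix.transpose_mul, h]
  exact v_mul_le_one_of_mul_diagonal_eq hT (fun i m => hY m i) j hj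

omit [DecidableEq n] in
/-- Products of integral matrices are integral (ultrametric inequality on `Σ_m A_{im} B_{mj}`). [cite: Cartier1979, §IV.1] -/
theorem v_mul_apply_le_one {A B : Matrix n n F} (hA : ∀ i j, Valued.v (A i j) ≤ 1) (hB : ∀ i j, Valued.v (B i j) ≤ 1) (i j : n) :
    Valued.v ((A * B) i j) ≤ 1 := by
  rw [Matrix.mul_apply]
  refine Valuation.map_sum_le _ fun m _ => ?_
  rw [map_mul]
  exact mul_le_one' (hA i m) (hB m j)

omit [Fintype n] in
/-- `Y − c·1` is integral when `Y` and `c` are. [cite: Cartier1979, §IV.1] -/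
theorem v_sub_smul_one_apply_le_one {Y : Matrix n n F} (hY : ∀ i j, Valued.v (Y i j) ≤ 1) {c : F} (hc : Valued.v c ≤ 1) (i j : n) :
    Valued.v ((Y - c • (1 : Matrix n n F)) i j) ≤ 1 := by
  rw [Matrix.sub_apply, Matrix.smul_apply, smul_eq_mul]
  refine (Valuation.map_sub _ _ _).trans (max_le (hY i j) ?_)
  by_cases hij : i = j
  · subst hij; rw [Matrix.one_apply_eq, mul_one]; exact hc
  · rw [Matrix.one_apply_ne hij, mul_zero, map_zero]; exact zero_le

end Lagrange

/-! ## §2 Theorem 18 at the split Cartan of `GL₃`, explicit -/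

section Thm18

variable {F : Type*} [Field F] [Valued F ℤᵐ⁰]

/-- The eigenvalues of an INTEGRAL `y = x t x⁻¹`, `t = diag(d)`, are integral: `|d_j| ≤ 1`. [cite: HarishChandra1970, Part VII §2 Theorem 18 p. 69] -/
theorem v_eigenvalue_le_one_of_conj {n : Type*} [Fintype n] [DecidableEq n] {t x : GL n F} {d : n → F} (ht : (t : Matrix n n F) = Matrix.diagonal d)
    (hy : ∀ i j, Valued.v (((x * t * x⁻¹ : GL n F) : Matrix n n F) i j) ≤ 1) (j : n) : Valued.v (d j) ≤ 1 := by
  have h : (x : Matrix n n F) * Matrix.diagonal d = ((x * t * x⁻¹ : GL n F) : Matrix n n F) * (x : Matrix n n F) := by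
    rw [← ht, ← Units.val_mul, ← Units.val_mul, inv_mul_cancel_right]
  have h1 := v_mul_le_one_of_mul_diagonal_eq h (c := 1) (fun i m => by rw [one_mul]; exact hy i m) j (exists_apply_ne_zero_of_col x j)
  rwa [one_mul] at h1

/-- If `ϖ^s y⁻¹` is integral for `y = x t x⁻¹`, `t = diag(d)`, then `|ϖ^s d_j⁻¹| ≤ 1` (row form on `t⁻¹ x⁻¹ = x⁻¹ y⁻¹`).
[cite: HarishChandra1970, Part VII §2 Theorem 18 p. 69] -/
theorem v_pow_mul_eigenvalue_inv_le_one_of_conj {n : Type*} [Fintype n] [DecidableEq n] {t x : GL n F} {d : n → F}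
    (ht : (t : Matrix n n F) = Matrix.diagonal d) {ϖ : F} {s : ℕ}
    (hy' : ∀ i j, Valued.v (ϖ ^ s * (((x * t * x⁻¹)⁻¹ : GL n F) : Matrix n n F) i j) ≤ 1) (j : n) : Valued.v (ϖ ^ s * (d j)⁻¹) ≤ 1 := by
  have ht' := coe_inv_eq_diagonal_inv ht
  have h : Matrix.diagonal (fun i => (d i)⁻¹) * ((x⁻¹ : GL n F) : Matrix n n F) =
      ((x⁻¹ : GL n F) : Matrix n n F) * (((x * t * x⁻¹)⁻¹ : GL n F) : Matrix n n F) := by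
    rw [← ht', ← Units.val_mul, ← Units.val_mul]
    congr 1
    group
  exact v_mul_le_one_of_diagonal_mul_eq h hy' j (exists_apply_ne_zero_of_row x⁻¹ j)

/-- **`|Δ_k · x_{ik} (x⁻¹)_{kl}| ≤ 1`** for an integral `y = x t x⁻¹` (`t = diag(d)`), where `Δ_k = (d_k − c₁)(d_k − c₂)` for integral `c₁, c₂` killing the other diagonal
entries — the Lagrange identity with an integral right-hand side. [cite: HarishChandra1970, Part VII §2 Theorem 18 p. 69] -/
theorem v_apply_mul_delta_mul_inv_apply_le_one {n : Type*} [Fintype n] [DecidableEq n] {t x : GL n F} {d : n → F} (ht : (t : Matrix n n F) = Matrix.diagonal d)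
    (hy : ∀ i j, Valued.v (((x * t * x⁻¹ : GL n F) : Matrix n n F) i j) ≤ 1) (k : n) {c₁ c₂ : F} (hc₁ : Valued.v c₁ ≤ 1) (hc₂ : Valued.v c₂ ≤ 1)
    (hk : ∀ m, m ≠ k → (d m - c₁) * (d m - c₂) = 0) (i l : n) :
    Valued.v ((x : Matrix n n F) i k * ((d k - c₁) * (d k - c₂)) * ((x⁻¹ : GL n F) : Matrix n n F) k l) ≤ 1 := by
  rw [apply_mul_mul_inv_apply_eq_of_forall_ne ht k hk x i l]
  exact v_mul_apply_le_one (v_sub_smul_one_apply_le_one hy hc₁) (v_sub_smul_one_apply_le_one hy hc₂) i l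

/-- A difference of integral elements squared… is integral: `|(a − b)(a − c)| ≤ 1` for `|a|, |b|, |c| ≤ 1`. [folklore] -/
theorem v_sub_mul_sub_le_one {a b c : F} (ha : Valued.v a ≤ 1) (hb : Valued.v b ≤ 1) (hc : Valued.v c ≤ 1) :
    Valued.v ((a - b) * (a - c)) ≤ 1 := by
  rw [map_mul]
  exact mul_le_one' ((Valuation.map_sub _ _ _).trans (max_le ha hb)) ((Valuation.map_sub _ _ _).trans (max_le ha hc))

/-- **`|δ · x_{ik} (x⁻¹)_{kl}| ≤ 1`** for an integral `y = x t x⁻¹`, `t = diag(d₀, d₁, d₂)`, with `δ = ((d₀−d₁)(d₀−d₂)(d₁−d₂))² = −Δ₀Δ₁Δ₂` (each `|Δ| ≤ 1`).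
[cite: HarishChandra1970, Part VII §2 Theorem 18 p. 69] -/
theorem v_disc_mul_apply_mul_inv_apply_le_one {t x : GL (Fin 3) F} {d : Fin 3 → F} (ht : (t : Matrix (Fin 3) (Fin 3) F) = Matrix.diagonal d)
    (hy : ∀ i j, Valued.v (((x * t * x⁻¹ : GL (Fin 3) F) : Matrix (Fin 3) (Fin 3) F) i j) ≤ 1) (i k l : Fin 3) :
    Valued.v (((d 0 - d 1) * (d 0 - d 2) * (d 1 - d 2)) ^ 2 * ((x : Matrix (Fin 3) (Fin 3) F) i k * ((x⁻¹ : GL (Fin 3) F) : Matrix (Fin 3) (Fin 3) F) k l)) ≤ 1 := by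
  have hd : ∀ j, Valued.v (d j) ≤ 1 := v_eigenvalue_le_one_of_conj ht hy
  have hΔ0 : Valued.v ((d 0 - d 1) * (d 0 - d 2)) ≤ 1 := v_sub_mul_sub_le_one (hd 0) (hd 1) (hd 2)
  have hΔ1 : Valued.v ((d 1 - d 0) * (d 1 - d 2)) ≤ 1 := v_sub_mul_sub_le_one (hd 1) (hd 0) (hd 2)
  have hΔ2 : Valued.v ((d 2 - d 0) * (d 2 - d 1)) ≤ 1 := v_sub_mul_sub_le_one (hd 2) (hd 0) (hd 1)
  set X : Matrix (Fin 3) (Fin 3) F := (x : Matrix (Fin 3) (Fin 3) F) with hX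
  set X' : Matrix (Fin 3) (Fin 3) F := ((x⁻¹ : GL (Fin 3) F) : Matrix (Fin 3) (Fin 3) F) with hX'
  have h3 : ∀ m : Fin 3, m = 0 ∨ m = 1 ∨ m = 2 := by decide
  obtain rfl | rfl | rfl := h3 k
  · have hL := v_apply_mul_delta_mul_inv_apply_le_one ht hy 0 (hd 1) (hd 2) (fun m hm => by
      obtain rfl | rfl | rfl := h3 m
      · exact absurd rfl hm
      · rw [sub_self, zero_mul]
      · rw [sub_self, mul_zero]) i l
    have heq : ((d 0 - d 1) * (d 0 - d 2) * (d 1 - d 2)) ^ 2 * (X i 0 * X' 0 l) =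
        -((X i 0 * ((d 0 - d 1) * (d 0 - d 2)) * X' 0 l) * (((d 1 - d 0) * (d 1 - d 2)) * ((d 2 - d 0) * (d 2 - d 1)))) := by ring
    rw [heq, Valuation.map_neg]
    exact (map_mul _ _ _).trans_le (mul_le_one' hL ((map_mul _ _ _).trans_le (mul_le_one' hΔ1 hΔ2)))
  · have hL := v_apply_mul_delta_mul_inv_apply_le_one ht hy 1 (hd 0) (hd 2) (fun m hm => by
      obtain rfl | rfl | rfl := h3 m
      · rw [sub_self, zero_mul]
      · exact absurd rfl hm
      · rw [sub_self, mul_zero]) i l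
    have heq : ((d 0 - d 1) * (d 0 - d 2) * (d 1 - d 2)) ^ 2 * (X i 1 * X' 1 l) =
        -((X i 1 * ((d 1 - d 0) * (d 1 - d 2)) * X' 1 l) * (((d 0 - d 1) * (d 0 - d 2)) * ((d 2 - d 0) * (d 2 - d 1)))) := by ring
    rw [heq, Valuation.map_neg]
    exact (map_mul _ _ _).trans_le (mul_le_one' hL ((map_mul _ _ _).trans_le (mul_le_one' hΔ0 hΔ2)))
  · have hL := v_apply_mul_delta_mul_inv_apply_le_one ht hy 2 (hd 0) (hd 1) (fun m hm => by
      obtain rfl | rfl | rfl := h3 m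
      · rw [sub_self, zero_mul]
      · rw [sub_self, mul_zero]
      · exact absurd rfl hm) i l
    have heq : ((d 0 - d 1) * (d 0 - d 2) * (d 1 - d 2)) ^ 2 * (X i 2 * X' 2 l) =
        -((X i 2 * ((d 2 - d 0) * (d 2 - d 1)) * X' 2 l) * (((d 0 - d 1) * (d 0 - d 2)) * ((d 1 - d 0) * (d 1 - d 2)))) := by ring
    rw [heq, Valuation.map_neg]
    exact (map_mul _ _ _).trans_le (mul_le_one' hL ((map_mul _ _ _).trans_le (mul_le_one' hΔ0 hΔ1)))

/-- **THEOREM 18 AT THE SPLIT CARTAN, NORMALISED FORM WITH A PRESCRIBED NORMALISATION.**  If `y = x t x⁻¹` (`t = diag(d₀,d₁,d₂)`) is integral with `ϖ^s y⁻¹`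
integral and `|ϖ^L (d₀d₁d₂)²| ≤ |δ|` (`δ = ((d₀−d₁)(d₀−d₂)(d₁−d₂))²`, i.e. `|D♮(t)| ≥ q^{−L}` for the scale-invariant discriminant `D♮ = δ∕(d₀d₁d₂)²`), then for ANY
exponent vector `e` normalising the columns of `x` (`|x_{ik}| ≤ exp(e_k)` with equality attained in each column) the element `a = diag(ϖ^{e})` has `x · a ∈ 𝔅_{6s+L}` — the
choice of `a` is exposed so that T18-mixed can run the same argument over a quadratic `E` with a Galois-equivariant `e`. [cite: HarishChandra1970, Part VII §2
Theorem 18 p. 69, Corollary p. 69] -/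
theorem adBall_mul_zpowDiagGL_of_conj_integral_of_colMax {ϖ : F} (hϖ : Valued.v ϖ = WithZero.exp (-1 : ℤ)) (hϖ0 : ϖ ≠ 0)
    {t x : GL (Fin 3) F} {d : Fin 3 → F} (ht : (t : Matrix (Fin 3) (Fin 3) F) = Matrix.diagonal d) {s L : ℕ}
    (hy : ∀ i j, Valued.v (((x * t * x⁻¹ : GL (Fin 3) F) : Matrix (Fin 3) (Fin 3) F) i j) ≤ 1)
    (hy' : ∀ i j, Valued.v (ϖ ^ s * (((x * t * x⁻¹)⁻¹ : GL (Fin 3) F) : Matrix (Fin 3) (Fin 3) F) i j) ≤ 1)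
    (hD : Valued.v (ϖ ^ L * (d 0 * d 1 * d 2) ^ 2) ≤ Valued.v (((d 0 - d 1) * (d 0 - d 2) * (d 1 - d 2)) ^ 2))
    (e : Fin 3 → ℤ) (hle : ∀ i k, Valued.v ((x : Matrix (Fin 3) (Fin 3) F) i k) ≤ WithZero.exp (e k))
    (hex : ∀ k, ∃ i, Valued.v ((x : Matrix (Fin 3) (Fin 3) F) i k) = WithZero.exp (e k)) :
    ∀ i j k l, Valued.v (ϖ ^ (6 * s + L) * (((x * zpowDiagGL (n := 3) hϖ0 e : GL (Fin 3) F) : Matrix (Fin 3) (Fin 3) F) i j *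
      (((x * zpowDiagGL (n := 3) hϖ0 e)⁻¹ : GL (Fin 3) F) : Matrix (Fin 3) (Fin 3) F) k l)) ≤ 1 := by
  set X : Matrix (Fin 3) (Fin 3) F := (x : Matrix (Fin 3) (Fin 3) F) with hX
  set X' : Matrix (Fin 3) (Fin 3) F := ((x⁻¹ : GL (Fin 3) F) : Matrix (Fin 3) (Fin 3) F) with hX'
  -- the top entry of each column: `|X (i₀ k) k| = exp (e k)`
  choose i₀ hγ using hex
  have hmax : ∀ k i, Valued.v (X i k) ≤ Valued.v (X (i₀ k) k) := fun k i => (hle i k).trans_eq (hγ k).symm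
  have hve : ∀ k, Valued.v (ϖ ^ (e k)) = WithZero.exp (-e k) := fun k => by
    rw [map_zpow₀, hϖ, ← WithZero.exp_zsmul, smul_eq_mul, mul_neg, mul_one]
  have hve' : ∀ k, Valued.v (ϖ ^ (-e k)) = Valued.v (X (i₀ k) k) := fun k => by
    rw [map_zpow₀, hϖ, ← WithZero.exp_zsmul, smul_eq_mul, mul_neg, mul_one, neg_neg, hγ]
  -- entries of `x a` and `(x a)⁻¹`
  have hxa : ∀ i j, ((x * zpowDiagGL (n := 3) hϖ0 e : GL (Fin 3) F) : Matrix (Fin 3) (Fin 3) F) i j = X i j * ϖ ^ (e j) := fun i j => by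
    rw [Units.val_mul, coe_zpowDiagGL, Matrix.mul_diagonal]
  have hxa' : ∀ k l, (((x * zpowDiagGL (n := 3) hϖ0 e)⁻¹ : GL (Fin 3) F) : Matrix (Fin 3) (Fin 3) F) k l = ϖ ^ (-e k) * X' k l := fun k l => by
    rw [_root_.mul_inv_rev, ← zpowDiagGL_neg, Units.val_mul, coe_zpowDiagGL, Matrix.diagonal_mul, Pi.neg_apply]
  -- `|ϖ^{6s+L}| ≤ |δ|`
  have hd' : ∀ j, Valued.v (ϖ ^ s) ≤ Valued.v (d j) := by
    intro j
    have h1 := v_pow_mul_eigenvalue_inv_le_one_of_conj ht hy' j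
    have hdj0 : d j ≠ 0 := by
      intro h0
      rw [h0, _root_.inv_zero, mul_zero, map_zero] at h1
      -- then `|ϖ^s · 0| = 0 ≤ 1` carries no information; but `d j = 0` contradicts invertibility of `t`
      have hdet : ((t * t⁻¹ : GL (Fin 3) F) : Matrix (Fin 3) (Fin 3) F) j j = 1 := by rw [mul_inv_cancel, Units.val_one, Matrix.one_apply_eq]
      rw [Units.val_mul, ht, Matrix.diagonal_mul, h0, zero_mul] at hdet
      exact zero_ne_one hdet
    have hvdj : Valued.v (d j) ≠ 0 := (Valuation.ne_zero_iff _).2 hdj0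
    calc Valued.v (ϖ ^ s) = Valued.v (ϖ ^ s * (d j)⁻¹) * Valued.v (d j) := by rw [← map_mul, inv_mul_cancel_right₀ hdj0]
      _ ≤ 1 * Valued.v (d j) := mul_le_mul_left h1 _
      _ = Valued.v (d j) := one_mul _
  have hϖδ : Valued.v (ϖ ^ (6 * s + L)) ≤ Valued.v (((d 0 - d 1) * (d 0 - d 2) * (d 1 - d 2)) ^ 2) := by
    have h3s : Valued.v (ϖ ^ s * ϖ ^ s * ϖ ^ s) ≤ Valued.v (d 0 * d 1 * d 2) := by
      simp only [map_mul]
      exact mul_le_mul' (mul_le_mul' (hd' 0) (hd' 1)) (hd' 2)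
    have h6 : Valued.v (ϖ ^ (6 * s)) ≤ Valued.v ((d 0 * d 1 * d 2) ^ 2) := by
      have heq : ϖ ^ (6 * s) = (ϖ ^ s * ϖ ^ s * ϖ ^ s) * (ϖ ^ s * ϖ ^ s * ϖ ^ s) := by ring
      rw [heq, sq]
      exact (map_mul _ _ _).trans_le ((mul_le_mul' h3s h3s).trans_eq (map_mul _ _ _).symm)
    calc Valued.v (ϖ ^ (6 * s + L)) = Valued.v (ϖ ^ L) * Valued.v (ϖ ^ (6 * s)) := by rw [pow_add, map_mul, mul_comm]
      _ ≤ Valued.v (ϖ ^ L) * Valued.v ((d 0 * d 1 * d 2) ^ 2) := mul_le_mul_right h6 _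
      _ = Valued.v (ϖ ^ L * (d 0 * d 1 * d 2) ^ 2) := (map_mul _ _ _).symm
      _ ≤ Valued.v (((d 0 - d 1) * (d 0 - d 2) * (d 1 - d 2)) ^ 2) := hD
  intro i j k l
  rw [hxa, hxa']
  -- `|ϖ^{6s+L} (X_{ij} ϖ^{e_j}) (ϖ^{-e_k} X'_{kl})| = (|X_{ij}| e^{-e_j}) · (|ϖ^{6s+L}| · |X_{i₀(k) k} X'_{kl}|) ≤ 1 · |δ X_{i₀ k} X'_{kl}| ≤ 1`
  have heq : ϖ ^ (6 * s + L) * (X i j * ϖ ^ e j * (ϖ ^ (-e k) * X' k l)) = (X i j * ϖ ^ e j) * (ϖ ^ (6 * s + L) * (ϖ ^ (-e k) * X' k l)) := by ring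
  rw [heq, map_mul]
  refine mul_le_one' ?_ ?_
  · rw [map_mul, hve j]
    calc Valued.v (X i j) * WithZero.exp (-e j) ≤ WithZero.exp (e j) * WithZero.exp (-e j) := mul_le_mul_left ((hmax j i).trans_eq (hγ j)) _
      _ = 1 := by rw [← WithZero.exp_add, add_neg_cancel, WithZero.exp_zero]
  · rw [map_mul, map_mul, hve' k, ← map_mul, ← map_mul]
    calc Valued.v (ϖ ^ (6 * s + L) * (X (i₀ k) k * X' k l)) = Valued.v (ϖ ^ (6 * s + L)) * Valued.v (X (i₀ k) k * X' k l) := map_mul _ _ _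
      _ ≤ Valued.v (((d 0 - d 1) * (d 0 - d 2) * (d 1 - d 2)) ^ 2) * Valued.v (X (i₀ k) k * X' k l) := mul_le_mul_left hϖδ _
      _ = Valued.v (((d 0 - d 1) * (d 0 - d 2) * (d 1 - d 2)) ^ 2 * (X (i₀ k) k * X' k l)) := (map_mul _ _ _).symm
      _ ≤ 1 := v_disc_mul_apply_mul_inv_apply_le_one ht hy (i₀ k) k l

/-- **THEOREM 18 AT THE SPLIT CARTAN, NORMALISED FORM**: under the hypotheses of `adBall_mul_zpowDiagGL_of_conj_integral_of_colMax`, SOME `a = diag(ϖ^{e})`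
(column maxima: `e_k = log max_i |x_{ik}|`) has `x · a ∈ 𝔅_{6s+L}`. [cite: HarishChandra1970, Part VII §2 Theorem 18 p. 69, Corollary p. 69] -/
theorem exists_adBall_mul_zpowDiagGL_of_conj_integral {ϖ : F} (hϖ : Valued.v ϖ = WithZero.exp (-1 : ℤ)) (hϖ0 : ϖ ≠ 0)
    {t x : GL (Fin 3) F} {d : Fin 3 → F} (ht : (t : Matrix (Fin 3) (Fin 3) F) = Matrix.diagonal d) {s L : ℕ}
    (hy : ∀ i j, Valued.v (((x * t * x⁻¹ : GL (Fin 3) F) : Matrix (Fin 3) (Fin 3) F) i j) ≤ 1)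
    (hy' : ∀ i j, Valued.v (ϖ ^ s * (((x * t * x⁻¹)⁻¹ : GL (Fin 3) F) : Matrix (Fin 3) (Fin 3) F) i j) ≤ 1)
    (hD : Valued.v (ϖ ^ L * (d 0 * d 1 * d 2) ^ 2) ≤ Valued.v (((d 0 - d 1) * (d 0 - d 2) * (d 1 - d 2)) ^ 2)) :
    ∃ e : Fin 3 → ℤ, ∀ i j k l, Valued.v (ϖ ^ (6 * s + L) * (((x * zpowDiagGL (n := 3) hϖ0 e : GL (Fin 3) F) : Matrix (Fin 3) (Fin 3) F) i j *
      (((x * zpowDiagGL (n := 3) hϖ0 e)⁻¹ : GL (Fin 3) F) : Matrix (Fin 3) (Fin 3) F) k l)) ≤ 1 := by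
  -- the top entry of each column and its valuation `exp (e k)`
  have hcol : ∀ k : Fin 3, ∃ i₀ : Fin 3, (∀ i, Valued.v ((x : Matrix (Fin 3) (Fin 3) F) i k) ≤ Valued.v ((x : Matrix (Fin 3) (Fin 3) F) i₀ k)) ∧
      Valued.v ((x : Matrix (Fin 3) (Fin 3) F) i₀ k) ≠ 0 := by
    intro k
    obtain ⟨i₁, hi₁⟩ := exists_apply_ne_zero_of_col x k
    obtain ⟨i₀, -, hi₀⟩ := Finset.exists_max_image (Finset.univ : Finset (Fin 3)) (fun i => Valued.v ((x : Matrix (Fin 3) (Fin 3) F) i k)) ⟨i₁, Finset.mem_univ _⟩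
    refine ⟨i₀, fun i => hi₀ i (Finset.mem_univ _), fun h0 => ?_⟩
    have h1 := hi₀ i₁ (Finset.mem_univ _)
    rw [h0, le_zero_iff] at h1
    exact hi₁ ((Valuation.zero_iff _).1 h1)
  choose i₀ hmax hne using hcol
  refine ⟨fun k => WithZero.log (Valued.v ((x : Matrix (Fin 3) (Fin 3) F) (i₀ k) k)),
    adBall_mul_zpowDiagGL_of_conj_integral_of_colMax hϖ hϖ0 ht hy hy' hD _ (fun i k => ?_) (fun k => ⟨i₀ k, (WithZero.exp_log (hne k)).symm⟩)⟩
  rw [WithZero.exp_log (hne k)]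
  exact hmax k i

/-- **THEOREM 18 AT THE SPLIT CARTAN OF `GL₃`, SCALE-INVARIANT FORM** (Harish-Chandra's Theorem 18 AND its Corollary, explicit exponent).  For `t = diag(d)` and any
`x`: if `x t x⁻¹ ∈ 𝔅_s` (the scale-invariant height ball of ★ B4-0) and `|ϖ^L (d₀d₁d₂)²| ≤ |((d₀−d₁)(d₀−d₂)(d₁−d₂))²|` (`|D♮(t)| ≥ q^{−L}`; this encodes
regularity), then `x · a ∈ 𝔅_{6s+L}` for some `a = diag(ϖ^{e}) ∈ A`.  Used with `s := R₀` (`tsupport θ ⊆ Ω R₀`) it is the support input `m_C = 6R₀ + L` of Theorem 20;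
with `s := σ(x t x⁻¹)` it is the `y₀`-normalisation of p. 71 (ii). [cite: HarishChandra1970, Part VII §2 Theorem 18 p. 69, Corollary p. 69; §3 p. 71 (ii)] -/
theorem exists_adBall_mul_zpowDiagGL_of_adBall_conj {ϖ : F} (hϖ : Valued.v ϖ = WithZero.exp (-1 : ℤ)) (hϖ0 : ϖ ≠ 0)
    {t x : GL (Fin 3) F} {d : Fin 3 → F} (ht : (t : Matrix (Fin 3) (Fin 3) F) = Matrix.diagonal d) {s L : ℕ}
    (hy : ∀ i j k l, Valued.v (ϖ ^ s * (((x * t * x⁻¹ : GL (Fin 3) F) : Matrix (Fin 3) (Fin 3) F) i j *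
      (((x * t * x⁻¹)⁻¹ : GL (Fin 3) F) : Matrix (Fin 3) (Fin 3) F) k l)) ≤ 1)
    (hD : Valued.v (ϖ ^ L * (d 0 * d 1 * d 2) ^ 2) ≤ Valued.v (((d 0 - d 1) * (d 0 - d 2) * (d 1 - d 2)) ^ 2)) :
    ∃ e : Fin 3 → ℤ, ∀ i j k l, Valued.v (ϖ ^ (6 * s + L) * (((x * zpowDiagGL (n := 3) hϖ0 e : GL (Fin 3) F) : Matrix (Fin 3) (Fin 3) F) i j *
      (((x * zpowDiagGL (n := 3) hϖ0 e)⁻¹ : GL (Fin 3) F) : Matrix (Fin 3) (Fin 3) F) k l)) ≤ 1 := by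
  -- rescale `y = x t x⁻¹` and `t` together by `c = ϖ^{k₀}`
  obtain ⟨k₀, hk, hk'⟩ := exists_zpow_scalar_mul_integral_of_adBall hϖ hϖ0 hy
  set c : Fˣ := Units.mk0 ϖ hϖ0 ^ k₀ with hc
  set t' : GL (Fin 3) F := Matrix.GeneralLinearGroup.scalar (Fin 3) c * t with ht'def
  have ht' : (t' : Matrix (Fin 3) (Fin 3) F) = Matrix.diagonal fun i => (c : F) * d i := by
    rw [ht'def, Units.val_mul, Matrix.GeneralLinearGroup.coe_scalar, Matrix.scalar_apply, ht, Matrix.diagonal_mul_diagonal]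
  have hconj : Matrix.GeneralLinearGroup.scalar (Fin 3) c * (x * t * x⁻¹) = x * t' * x⁻¹ := by
    rw [ht'def, ← mul_assoc, ← mul_assoc, Matrix.GeneralLinearGroup.scalar_commute, mul_assoc x]
  rw [hconj] at hk hk'
  have hD' : Valued.v (ϖ ^ L * ((c : F) * d 0 * ((c : F) * d 1) * ((c : F) * d 2)) ^ 2) ≤
      Valued.v ((((c : F) * d 0 - (c : F) * d 1) * ((c : F) * d 0 - (c : F) * d 2) * ((c : F) * d 1 - (c : F) * d 2)) ^ 2) := by
    have h1 : ϖ ^ L * ((c : F) * d 0 * ((c : F) * d 1) * ((c : F) * d 2)) ^ 2 = (c : F) ^ 6 * (ϖ ^ L * (d 0 * d 1 * d 2) ^ 2) := by ring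
    have h2 : (((c : F) * d 0 - (c : F) * d 1) * ((c : F) * d 0 - (c : F) * d 2) * ((c : F) * d 1 - (c : F) * d 2)) ^ 2 =
        (c : F) ^ 6 * (((d 0 - d 1) * (d 0 - d 2) * (d 1 - d 2)) ^ 2) := by ring
    rw [h1, h2]
    exact (map_mul _ _ _).trans_le ((mul_le_mul_right hD _).trans_eq (map_mul _ _ _).symm)
  exact exists_adBall_mul_zpowDiagGL_of_conj_integral hϖ hϖ0 ht' hk hk' hD'

/-- **A DEPTH EXISTS FOR REGULAR `t`**: for `d` injective with non-zero entries there is `L` with `|ϖ^L (d₀d₁d₂)²| ≤ |((d₀−d₁)(d₀−d₂)(d₁−d₂))²|`.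
[cite: HarishChandra1970, Part VII §2 p. 69] -/
theorem exists_depth_of_injective {ϖ : F} (hϖ : Valued.v ϖ = WithZero.exp (-1 : ℤ)) {d : Fin 3 → F} (hd : Function.Injective d) :
    ∃ L : ℕ, Valued.v (ϖ ^ L * (d 0 * d 1 * d 2) ^ 2) ≤ Valued.v (((d 0 - d 1) * (d 0 - d 2) * (d 1 - d 2)) ^ 2) := by
  have hδ0 : ((d 0 - d 1) * (d 0 - d 2) * (d 1 - d 2)) ^ 2 ≠ 0 := by
    refine pow_ne_zero 2 (mul_ne_zero (mul_ne_zero ?_ ?_) ?_) <;> rw [sub_ne_zero] <;> intro h <;> exact absurd (hd h) (by decide)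
  set P : F := (d 0 * d 1 * d 2) ^ 2 with hP
  set δ : F := ((d 0 - d 1) * (d 0 - d 2) * (d 1 - d 2)) ^ 2 with hδ
  obtain ⟨N, hN⟩ := exists_forall_v_pow_mul_le_one hϖ (P / δ)
  refine ⟨N, ?_⟩
  have h1 := hN N le_rfl
  calc Valued.v (ϖ ^ N * P) = Valued.v (ϖ ^ N * (P / δ) * δ) := by rw [mul_assoc, div_mul_cancel₀ P hδ0]
    _ = Valued.v (ϖ ^ N * (P / δ)) * Valued.v δ := map_mul _ _ _
    _ ≤ 1 * Valued.v δ := mul_le_mul_left h1 _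
    _ = Valued.v δ := one_mul _

end Thm18

end Summit.HodgeConjecture.HodgeConjecture.Cruxes.H413.K2E3GL3TruncatedCharSplitTorusRadius

end
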